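import Mathlib
import Summits.AnomalousDissipation.AnomalousDissipation.Theses.DyadicWallCascade
import Literature.Analysis.FunctionSpaces.TorusLerayHelmholtzProofs
import Literature.Analysis.FunctionSpaces.TorusVerticalLift
import Summits.AnomalousDissipation.AnomalousDissipation.Theorems.DyadicWallCascadeDyadicRealisationLerayCappingTools4
import Summits.AnomalousDissipation.AnomalousDissipation.Theorems.DyadicWallCascadeDyadicRealisationLerayCappingTools7
import Summits.AnomalousDissipation.AnomalousDissipation.Theorems.DyadicWallCascadeDyadicRealisationLerayCappingTools8
import HarnessLib

/-!
# Leray capping of a half-space hierarchy (stub `stub_lerayCapping`, crux `DyadicRealisation`)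

Line Sketch of the crux `DyadicRealisation` (route `DyadicWallCascade`, `Summits/AnomalousDissipation`).
A half-space hierarchy `(V, Q, C, F)` with zero Reynolds stress `τ₀ = τ₁ = 0` is capped to the unit
torus: the tools files I–VIII construct the solenoidal lid `U = θV + θσV∘A + c` (vertical
cut-off, mirror image, row–column corrector), its pressure `P`, and the residual force
`R₀ = (U·∇)U + ∇P` (smooth on `ℝ³`, zero on the collar `|Y₂| < 1/16`), and compute `∫ R₀ = 0`,
`∫ ⟪R₀, U⟫ = −2F`.  Here the pair is read on `T³` (`r = R₀ ∘ repr`, `ū = U ∘ repr`), the force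
`f` is the solenoidal part of `r` in the smooth Helmholtz decomposition
(`Torus.smooth_helmholtz_holds`), and `π = P − φ₀` absorbs the gradient part.
-/

open Set Function MeasureTheory Filter Topology
open Literature.Analysis.FunctionSpaces
open scoped BigOperators ContDiff InnerProductSpace

set_option linter.dupNamespace false

namespace Summit.AnomalousDissipation.AnomalousDissipation.Theorems

/-- Constant vector fields on the torus are divergence free. [folklore] -/
theorem lerayCapping_isDivFree_const (c : EuclideanSpace ℝ (Fin 3)) :
    Torus.IsDivFree (fun _ : UnitAddTorus (Fin 3) => c) := by
  intro x
  simp [Torus.divergence, Torus.partialDeriv, Torus.lineDeriv]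

/-- The coordinate integrals of a torus gradient vanish. [folklore] -/
theorem lerayCapping_integral_gradient_apply {φ₀ : UnitAddTorus (Fin 3) → ℝ} (hφ₀ : Torus.IsSmooth φ₀)
    (j : Fin 3) : ∫ x, (Torus.gradient φ₀ x) j = 0 := by
  have h := Torus.integral_inner_gradient_eq_zero_of_isDivFree
    (Torus.isSmooth_const (EuclideanSpace.single j (1 : ℝ))) hφ₀
    (lerayCapping_isDivFree_const (EuclideanSpace.single j (1 : ℝ)))
  simpa [EuclideanSpace.inner_single_right] using h

/-- The lift of a torus gradient is the gradient of the lift. [folklore] -/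
theorem lerayCapping_gradient_lift (φ₀ : UnitAddTorus (Fin 3) → ℝ) (Y : EuclideanSpace ℝ (Fin 3)) :
    gradient (Torus.lift φ₀) Y = Torus.gradient φ₀ (Torus.proj Y) := by
  rw [gradient, Torus.fderiv_lift]
  rfl

/-- **Leray capping of a half-space hierarchy** (stub `stub_lerayCapping` of the line Sketch of
crux `DyadicRealisation`): see the module docstring. [folklore] -/
theorem stub_lerayCapping : ∀ (V : EuclideanSpace ℝ (Fin 3) → EuclideanSpace ℝ (Fin 3)) (Q : EuclideanSpace ℝ (Fin 3) → ℝ) (C F : ℝ), ContDiffOn ℝ ((⊤ : ℕ∞) : WithTop ℕ∞) V {X : EuclideanSpace ℝ (Fin 3) | 0 < X 2} ∧ ContDiffOn ℝ ((⊤ : ℕ∞) : WithTop ℕ∞) Q {X : EuclideanSpace ℝ (Fin 3) | 0 < X 2} ∧ (∀ X : EuclideanSpace ℝ (Fin 3), 0 < X 2 → ‖V X‖ ≤ C ∧ |Q X| ≤ C) ∧ (∀ X : EuclideanSpace ℝ (Fin 3), 0 < X 2 → ∑ i : Fin 3, (fderiv ℝ V X (EuclideanSpace.single i (1 : ℝ)))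 i = 0) ∧ (∀ X : EuclideanSpace ℝ (Fin 3), 0 < X 2 → (fderiv ℝ V X) (V X) + gradient Q X = 0) ∧ (∀ X : EuclideanSpace ℝ (Fin 3), 0 < X 2 → V ((2 : ℝ) • X) = V X ∧ Q ((2 : ℝ) • X) = Q X) ∧ (∀ X : EuclideanSpace ℝ (Fin 3), 1 ≤ X 2 → X 2 ≤ 2 → V (X + EuclideanSpace.single 0 (1 : ℝ)) = V X ∧ V (X + EuclideanSpace.single 1 (1 : ℝ)) = V X ∧ Q (X + EuclideanSpace.single 0 (1 : ℝ)) = Q X ∧ Q (X + EuclideanSpace.single 1 (1 : ℝ)) = Q X) ∧ (∫ q in Set.Icc (0 : ℝ) 1 ×ˢ Set.Icc (0 : ℝ) 1, (V !₂[q.1, q.2, (1 : ℝ)]) 2 = 0) ∧ F ≠ 0 ∧ (∫ q in Set.Icc (0 : ℝ) 1 ×ˢ Set.Icc (0 : ℝ) 1, (V !₂[q.1, q.2, (1 : ℝ)]) 2 * (‖V !₂[q.1, q.2, (1 : ℝ)]‖ ^ 2 / 2 + Q !₂[q.1, q.2, (1 : ℝ)]) = F) → (∫ q in Set.Icc (0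 : ℝ) 1 ×ˢ Set.Icc (0 : ℝ) 1, (V !₂[q.1, q.2, (1 : ℝ)]) 2 * (V !₂[q.1, q.2, (1 : ℝ)]) 0 = 0) → (∫ q in Set.Icc (0 : ℝ) 1 ×ˢ Set.Icc (0 : ℝ) 1, (V !₂[q.1, q.2, (1 : ℝ)]) 2 * (V !₂[q.1, q.2, (1 : ℝ)]) 1 = 0) → ∃ (f r ub : UnitAddTorus (Fin 3) → EuclideanSpace ℝ (Fin 3)) (π : EuclideanSpace ℝ (Fin 3) → ℝ) (C' : ℝ), Literature.Analysis.FunctionSpaces.Torus.IsSmooth f ∧ Literature.Analysis.FunctionSpaces.Torus.IsDivFree f ∧ Literature.Analysis.FunctionSpaces.Torus.HasZeroMean f ∧ Literature.Analysis.FunctionSpaces.Torus.IsSmooth r ∧ (∀ Y : EuclideanSpace ℝ (Fin 3), |Y 2| < 1 / 16 → Literature.Analysis.FunctionSpaces.Torus.lift r Y = 0) ∧ (∀ w : UnitAddTorus (Fin 3) → EuclideanSpace ℝ (Fin 3), Literature.Analysis.FunctionSpaces.Torus.IsSmooth w → Literature.Analysis.FunctionSpaces.Torus.IsDivFree w → ∫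 x, ⟪f x, w x⟫_ℝ = ∫ x, ⟪r x, w x⟫_ℝ) ∧ (∀ x, ‖ub x‖ ≤ C') ∧ (∀ Y : EuclideanSpace ℝ (Fin 3), 0 < Y 2 → Y 2 < 1 / 16 → Literature.Analysis.FunctionSpaces.Torus.lift ub Y = V Y) ∧ (∀ Y : EuclideanSpace ℝ (Fin 3), -(1 / 16) < Y 2 → Y 2 < 0 → Literature.Analysis.FunctionSpaces.Torus.lift ub Y = V (Y - (2 * Y 2) • EuclideanSpace.single 2 (1 : ℝ)) - (2 * (V (Y - (2 * Y 2) • EuclideanSpace.single 2 (1 : ℝ))) 2) • EuclideanSpace.single 2 (1 : ℝ)) ∧ ContDiffOn ℝ ((⊤ : ℕ∞) : WithTop ℕ∞) (Literature.Analysis.FunctionSpaces.Torus.lift ub) {Y : EuclideanSpace ℝ (Fin 3) | 0 < Y 2 ∧ Y 2 < 1} ∧ ContDiffOn ℝ ((⊤ : ℕ∞) : WithTop ℕ∞) π {Y : EuclideanSpace ℝ (Fin 3) | 0 < Y 2 ∧ Y 2 < 1} ∧ (∀ Y : EuclideanSpace ℝ (Fin 3), 0 < Y 2 → Y 2 < 1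 → ∑ i : Fin 3, (fderiv ℝ (Literature.Analysis.FunctionSpaces.Torus.lift ub) Y (EuclideanSpace.single i (1 : ℝ))) i = 0) ∧ (∀ Y : EuclideanSpace ℝ (Fin 3), 0 < Y 2 → Y 2 < 1 → (fderiv ℝ (Literature.Analysis.FunctionSpaces.Torus.lift ub) Y) (Literature.Analysis.FunctionSpaces.Torus.lift ub Y) + gradient π Y = Literature.Analysis.FunctionSpaces.Torus.lift f Y) ∧ ∫ x, ⟪r x, ub x⟫_ℝ = -2 * F := by
  intro V Q C F hH hτ0 hτ1
  obtain ⟨hV, hQ, hbd, hdiv, hE, hdil, hper, hmass, -, hflux⟩ := hH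
  obtain ⟨U, P, R₀, M, hU, hP, hperUP, hdivU, hlow, hup, hM, hR, hRper, hRz, hRf⟩ :=
    lerayCapping_capped_pair V Q C hV hQ hbd hdiv hE hdil hper hmass
  obtain ⟨hmean, hwork⟩ := lerayCapping_integrals V Q F U P R₀ hV hQ hdil hper hflux hτ0 hτ1 hU hP
    hperUP hdivU hlow hup hRz hRf
  set e2 : EuclideanSpace ℝ (Fin 3) := EuclideanSpace.single 2 (1 : ℝ) with he2
  set S : Set (EuclideanSpace ℝ (Fin 3)) := {Y | 0 < Y 2 ∧ Y 2 < 1} with hS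
  have hc2c : Continuous fun Y : EuclideanSpace ℝ (Fin 3) => Y 2 := PiLp.continuous_apply 2 _ 2
  have hSo : IsOpen S := (isOpen_lt continuous_const hc2c).inter (isOpen_lt hc2c continuous_const)
  have hUper0 : ∀ Y : EuclideanSpace ℝ (Fin 3), U (Y + EuclideanSpace.single 0 (1 : ℝ)) = U Y :=
    fun Y => (hperUP Y).1
  have hUper1 : ∀ Y : EuclideanSpace ℝ (Fin 3), U (Y + EuclideanSpace.single 1 (1 : ℝ)) = U Y :=
    fun Y => (hperUP Y).2.1
  have hRper0 : ∀ Y : EuclideanSpace ℝ (Fin 3), R₀ (Y + EuclideanSpace.single 0 (1 : ℝ)) = R₀ Y :=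
    fun Y => (hRper Y).1
  have hRper1 : ∀ Y : EuclideanSpace ℝ (Fin 3), R₀ (Y + EuclideanSpace.single 1 (1 : ℝ)) = R₀ Y :=
    fun Y => (hRper Y).2
  -- the torus objects
  set r : UnitAddTorus (Fin 3) → EuclideanSpace ℝ (Fin 3) := fun x => R₀ (Torus.repr x) with hr
  set ub : UnitAddTorus (Fin 3) → EuclideanSpace ℝ (Fin 3) := fun x => U (Torus.repr x) with hub
  have hr_lift : ∀ Y, Torus.lift r Y = R₀ (Torus.repr (Torus.proj Y)) := fun Y => rfl
  have hub_lift : ∀ Y, Torus.lift ub Y = U (Torus.repr (Torus.proj Y)) := fun Y => rfl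
  have hr_smooth : Torus.IsSmooth r :=
    lerayCapping_contDiff_comp_repr_proj R₀ hR hRper0 hRper1 (1 / 32) (by norm_num)
      (fun Y hY => hRz Y (by rcases hY with h | h <;> [left; right] <;> linarith))
  have hub_S : ∀ Y ∈ S, Torus.lift ub Y = U Y := fun Y hY =>
    (lerayCapping_comp_repr_proj_layers U hUper0 hUper1 Y).1 hY.1.le hY.2
  have hR_S : ∀ Y ∈ S, R₀ (Torus.repr (Torus.proj Y)) = R₀ Y := fun Y hY =>
    (lerayCapping_comp_repr_proj_layers R₀ hRper0 hRper1 Y).1 hY.1.le hY.2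
  -- Helmholtz decomposition of `r`
  obtain ⟨f, φ₀, hf, hφ₀, hfdiv, -, hdec⟩ := Torus.smooth_helmholtz_holds (Fin 3) r hr_smooth
  have hfr : f = fun x => r x - Torus.gradient φ₀ x := by
    funext x; rw [hdec x]; abel
  set π : EuclideanSpace ℝ (Fin 3) → ℝ := fun Y => P Y - Torus.lift φ₀ Y with hπ
  refine ⟨f, r, ub, π, M, hf, hfdiv, ?_, hr_smooth, ?_, ?_, ?_, ?_, ?_, ?_, ?_, ?_, ?_, ?_⟩
  · -- zero mean of `f`
    have hr_int : ∫ x, r x = 0 := by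
      refine lerayCapping_integral_eq_zero_of_forall_apply r hr_smooth.integrable fun j => ?_
      have h := Torus.integral_comp_repr (fun Y => (R₀ Y) j)
      simp only [hr]
      rw [h]
      exact hmean j
    have hg_int : ∫ x, Torus.gradient φ₀ x = 0 :=
      lerayCapping_integral_eq_zero_of_forall_apply _ hφ₀.gradient.integrable
        (lerayCapping_integral_gradient_apply hφ₀)
    show ∫ x, f x = 0
    rw [hfr, integral_sub hr_smooth.integrable hφ₀.gradient.integrable, hr_int, hg_int, sub_zero]
  · -- `r` vanishes on the collar
    intro Y hY
    rw [hr_lift]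
    obtain ⟨h0, h1⟩ := lerayCapping_comp_repr_proj_layers R₀ hRper0 hRper1 Y
    have hY' := abs_lt.1 hY
    rcases le_or_gt 0 (Y 2) with h | h
    · rw [h0 h (by linarith)]; exact hRz Y (Or.inl hY'.2)
    · rw [h1 (by linarith) h]
      exact hRz _ (Or.inr (by simp; linarith))
  · -- `f` is the solenoidal part of `r`
    intro w hw hwdiv
    have hsplit : ∀ x, ⟪r x, w x⟫_ℝ = ⟪f x, w x⟫_ℝ + ⟪Torus.gradient φ₀ x, w x⟫_ℝ := fun x => by
      rw [hdec x, inner_add_left]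
    simp_rw [hsplit]
    rw [integral_add (hf.inner hw).integrable (hφ₀.gradient.inner hw).integrable,
      Torus.integral_inner_gradient_eq_zero_of_isDivFree hw hφ₀ hwdiv, add_zero]
  · -- bound
    intro x
    exact hM _ fun i => ⟨(Torus.repr_apply_mem_Ico x i).1, (Torus.repr_apply_mem_Ico x i).2.le⟩
  · -- the lower collar
    intro Y hY0 hY1
    rw [hub_lift, (lerayCapping_comp_repr_proj_layers U hUper0 hUper1 Y).1 hY0.le (by linarith)]
    exact (hlow Y hY0 (by linarith)).1
  · -- the upper collar, read below the wall
    intro Y hY0 hY1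
    rw [hub_lift, (lerayCapping_comp_repr_proj_layers U hUper0 hUper1 Y).2 (by linarith) hY1]
    have hY2 : (Y + EuclideanSpace.single 2 (1 : ℝ) : EuclideanSpace ℝ (Fin 3)) 2 = Y 2 + 1 := by simp
    have h := (hup (Y + EuclideanSpace.single 2 (1 : ℝ)) (by rw [hY2]; linarith) (by rw [hY2]; linarith)).1
    have hAe : (Y + EuclideanSpace.single 2 (1 : ℝ) : EuclideanSpace ℝ (Fin 3)) +
        (1 - 2 * (Y + EuclideanSpace.single 2 (1 : ℝ) : EuclideanSpace ℝ (Fin 3)) 2) •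
          EuclideanSpace.single 2 (1 : ℝ) =
        Y - (2 * Y 2) • EuclideanSpace.single 2 (1 : ℝ) := by
      ext i; fin_cases i <;> simp
      ring
    rw [hAe] at h
    exact h
  · -- smoothness of the lid on the layer
    exact hU.congr hub_S
  · -- smoothness of the pressure on the layer
    exact hP.sub hφ₀.contDiffOn
  · -- divergence
    intro Y hY0 hY1
    have hev : Torus.lift ub =ᶠ[𝓝 Y] U := Filter.eventuallyEq_of_mem (hSo.mem_nhds ⟨hY0, hY1⟩) hub_S
    rw [hev.fderiv_eq]
    exact hdivU Y hY0 hY1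
  · -- Euler with force `f` and pressure `π`
    intro Y hY0 hY1
    have hYS : Y ∈ S := ⟨hY0, hY1⟩
    have hev : Torus.lift ub =ᶠ[𝓝 Y] U := Filter.eventuallyEq_of_mem (hSo.mem_nhds hYS) hub_S
    have hPd : DifferentiableAt ℝ P Y := (hP.differentiableOn (by simp)).differentiableAt (hSo.mem_nhds hYS)
    have hφd : DifferentiableAt ℝ (Torus.lift φ₀) Y := (hφ₀.differentiable (by simp)) Y
    have hgπ : gradient π Y = gradient P Y - gradient (Torus.lift φ₀) Y := by
      simp only [gradient, hπ]
      rw [fderiv_fun_sub hPd hφd, map_sub]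
    rw [hev.fderiv_eq, hub_S Y hYS, hgπ, Torus.lift_apply, hfr]
    simp only
    rw [show r (Torus.proj Y) = R₀ (Torus.repr (Torus.proj Y)) from rfl, hR_S Y hYS, hRf Y hY0 hY1,
      ← lerayCapping_gradient_lift]
    abel
  · -- the work
    have h := Torus.integral_comp_repr (fun Y => ⟪R₀ Y, U Y⟫_ℝ)
    simp only [hr, hub]
    rw [h]
    exact hwork

end Summit.AnomalousDissipation.AnomalousDissipation.Theorems
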